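import Summits.ResolutionOfSingularities.KangarooAtlas.MizutaniSchemeIdentity
import Summits.ResolutionOfSingularities.KangarooAtlas.MizutaniEdgeDatumBound
import HarnessLib

/-!
# `B_{P,𝔮} ⊆ B_{P,𝔭}` under specialisation `𝔭 ⊆ 𝔮`: the Hironaka group shrinks, `U(𝔭) ⊆ U(𝔮)`, `dim B` drops

Cell `pub-rosobs`, Mizutani enclosure (seat mizutani-encloser-2, gen 5). AI-written; AI review is weaker than expert
review; NOT a resolution-of-singularities theorem (summit relevance C).

> **Mizutani 1973, §1 (d) (p. 86).** "We call `p` in `Pⁿ` the most generic point associated with an `H`-scheme `B` in `Spec(S)` when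
> `B_{Pⁿ,p} = B` and an arbitrary `y ∈ Pⁿ`, which satisfies `B_{Pⁿ,y} = B`, contains `p`."

In Oda's printed description `(L_B)_e = {h ∈ L_e : D h ∈ 𝔭 ∀ D ∈ Diff_{p^e−1}(k/k^{p^e})}` (Publ. RIMS 19 p. 1168; the tree's DEFINITION
`invForms`) monotonicity in the point is EVIDENT: `𝔭 ⊆ 𝔮 ⇒ (L_B(𝔭))_e ⊆ (L_B(𝔮))_e`.  Transported through encloser-1 g4's Oda equality
`hirForms_eq_invForms` (every prime) and Hironaka's generation theorem, this gives the specialisation behaviour of Hironaka's / Mizutani's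
own objects — for which a direct proof would need the monotonicity of symbolic powers `𝔭^{(d)} ⊆ 𝔮^{(d)}` of regular rings (Zariski–Nagata),
not in the tree — all PROVED here for points `𝔭 ⊆ 𝔮` of `ℙ^n_k`:

* `invForms_mono` (every pair of ideals), **`hirForms_mono`** (every pair of primes: an additive form of multiplicity `p^e` at `𝔭` has
  multiplicity `p^e` at every specialisation `𝔮 ⊇ 𝔭`), `addForm_mem_symbPow_mono`;
* **`multAlgebra_mono`** (`U(𝔭) ⊆ U(𝔮)`), **`bIdeal_mono`** (`U_+(𝔭)S ⊆ U_+(𝔮)S`), **`pointsSubmodule_antitone`** (`B_{P,𝔮}(k') ⊆ B_{P,𝔭}(k')` for every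
  `k'`: the Hironaka group of a point CONTAINS those of its specialisations), `schemeIdeal_mono`;
* **`ringKrullDim_quotient_bIdeal_antitone`** (`dim B_{P,𝔮} ≤ dim B_{P,𝔭}`), `hsDim_antitone`, `ridgeDim_bIdeal_antitone`, and
  `r_le_r_of_le` (the number of triangular generators of `U` grows: `r(𝔭) ≤ r(𝔮)`);
* `hilbFun_mono`, **`ridgeEdgeInv_bIdeal_le_of_le`** — Hironaka's edge datum of `B_{P,𝔮}` is `≤` that of `B_{P,𝔭}` in his lexicographic order
  (tree `edgeInvK_le_of_hilbFun_le`).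

## References

* H. Mizutani, *Hironaka's additive group schemes*, Nagoya Math. J. 52 (1973), §1 (d), Def. 1.1. [Mizutani1973HironakaGroupSchemes]
* T. Oda, *Hironaka's additive group scheme. II*, Publ. RIMS 19 (1983), §2 p. 1168 (the description of `(L_B)_e`). [Oda1983HironakaGroupSchemeII]
-/

noncomputable section

open MvPolynomial Literature.AlgebraicGeometry.Resolution Literature.AlgebraicGeometry.Resolution.HironakaScheme
open Literature.AlgebraicGeometry.Hironaka2017.EdgeAlgebra

namespace Summit.ResolutionOfSingularities.KangarooAtlas.Mizutani

universe u v

section Forms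

variable (k : Type u) [Field k] (p : ℕ) [hp : Fact p.Prime] [CharP k p] {n : ℕ}
  {𝔭 𝔮 : Ideal (MvPolynomial (Fin (n + 1)) k)}

/-- **Oda's invariant forms are monotone in the point**: `𝔭 ⊆ 𝔮 ⇒ (L_B(𝔭))_e ⊆ (L_B(𝔮))_e` (evident from the printed description
`{h : D h ∈ 𝔭 ∀ D}`). [cite: Oda1983HironakaGroupSchemeII, §2 (p. 1168)] -/
theorem invForms_mono (h : 𝔭 ≤ 𝔮) (e : ℕ) : invForms k p 𝔭 e ≤ invForms k p 𝔮 e :=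
  fun _ ha D hD => h (ha D hD)

/-- **Hironaka's invariant additive forms are monotone under specialisation**: for primes `𝔭 ⊆ 𝔮`, `U(𝔭) ∩ L_e ⊆ U(𝔮) ∩ L_e` — an additive
form lying in `𝔭^{(p^e)}` lies in `𝔮^{(p^e)}` (via Oda's equality at both primes; no Zariski–Nagata needed).
[cite: Mizutani1973HironakaGroupSchemes, §1 (c), (d)] -/
theorem hirForms_mono [𝔭.IsPrime] [𝔮.IsPrime] (h : 𝔭 ≤ 𝔮) (e : ℕ) : hirForms k p 𝔭 e ≤ hirForms k p 𝔮 e := by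
  rw [hirForms_eq_invForms 𝔭, hirForms_eq_invForms 𝔮]
  exact invForms_mono k p h e

/-- The same in symbolic-power language: `Σ a_j X_j^{p^e} ∈ 𝔭^{(p^e)} ⇒ Σ a_j X_j^{p^e} ∈ 𝔮^{(p^e)}` for primes `𝔭 ⊆ 𝔮`.
[cite: Mizutani1973HironakaGroupSchemes, §1 (c), (d)] -/
theorem addForm_mem_symbPow_mono [𝔭.IsPrime] [𝔮.IsPrime] (h : 𝔭 ≤ 𝔮) {e : ℕ} {a : Fin (n + 1) → k}
    (ha : addForm k p e a ∈ symbPow k 𝔭 (p ^ e)) : addForm k p e a ∈ symbPow k 𝔮 (p ^ e) := by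
  have ha' : a ∈ hirForms k p 𝔭 e := mem_hirForms_iff.mpr ha
  exact mem_hirForms_iff.mp (hirForms_mono k p h e ha')

/-- The ideal of ALL of Oda's invariant forms is monotone: `schemeIdeal k p 𝔭 ≤ schemeIdeal k p 𝔮` for `𝔭 ⊆ 𝔮`.
[cite: Oda1983HironakaGroupSchemeII, §2 (p. 1168)] -/
theorem schemeIdeal_mono (h : 𝔭 ≤ 𝔮) : schemeIdeal k p 𝔭 ≤ schemeIdeal k p 𝔮 := by
  rw [schemeIdeal_eq, schemeIdeal_eq]
  refine Ideal.span_mono (Set.iUnion_mono fun e => Set.image_mono fun a ha => invForms_mono k p h e ha)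

end Forms

section Points

variable (k : Type u) [Field k] (p : ℕ) [hp : Fact p.Prime] [CharP k p] {n : ℕ}
  {𝔭 𝔮 : Ideal (MvPolynomial (Fin (n + 1)) k)}

include hp in
/-- **`U(𝔭) ⊆ U(𝔮)` for points `𝔭 ⊆ 𝔮`** (generation by additive forms at both points + `hirForms_mono`).
[cite: Mizutani1973HironakaGroupSchemes, §1 (d) and p. 85 L26–28] -/
theorem multAlgebra_mono [𝔭.IsPrime] [𝔮.IsPrime] (hP : IsPoint k 𝔭) (hQ : IsPoint k 𝔮) (h : 𝔭 ≤ 𝔮) :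
    multAlgebra k 𝔭 ≤ multAlgebra k 𝔮 := by
  rw [multAlgebra_eq_adjoin_range k p 𝔭 hP, multAlgebra_eq_adjoin_range k p 𝔮 hQ]
  refine Algebra.adjoin_le ?_
  rintro _ ⟨⟨e, a⟩, rfl⟩
  exact Algebra.subset_adjoin ⟨⟨e, ⟨a, hirForms_mono k p h e a.2⟩⟩, rfl⟩

include hp in
/-- **`U_+(𝔭)S ⊆ U_+(𝔮)S` for points `𝔭 ⊆ 𝔮`.** [cite: Mizutani1973HironakaGroupSchemes, Def. 1.1 and §1 (d)] -/
theorem bIdeal_mono [𝔭.IsPrime] [𝔮.IsPrime] (hP : IsPoint k 𝔭) (hQ : IsPoint k 𝔮) (h : 𝔭 ≤ 𝔮) : bIdeal k 𝔭 ≤ bIdeal k 𝔮 := by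
  rw [← schemeIdeal_eq_bIdeal k p 𝔭 hP, ← schemeIdeal_eq_bIdeal k p 𝔮 hQ]
  exact schemeIdeal_mono k p h

/-- **The Hironaka group shrinks under specialisation: `B_{P,𝔮}(k') ⊆ B_{P,𝔭}(k')`** for points `𝔭 ⊆ 𝔮` and every commutative `k`-algebra `k'`
(the group of the generic point of a closed subvariety contains the group of each of its points).
[cite: Mizutani1973HironakaGroupSchemes, §1 (d) (most generic point)] -/
theorem pointsSubmodule_antitone [𝔭.IsPrime] [𝔮.IsPrime] (hP : IsPoint k 𝔭) (hQ : IsPoint k 𝔮) (h : 𝔭 ≤ 𝔮)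
    (k' : Type v) [CommRing k'] [Algebra k k'] :
    pointsSubmodule k p 𝔮 k' hQ ≤ pointsSubmodule k p 𝔭 k' hP :=
  fun _ hv f hf => hv f (bIdeal_mono k p hP hQ h hf)

include hp in
/-- **`dim B_{P,𝔮} ≤ dim B_{P,𝔭}` for points `𝔭 ⊆ 𝔮`.** [cite: Mizutani1973HironakaGroupSchemes, §1 (d), Thm. 1.3] -/
theorem ringKrullDim_quotient_bIdeal_antitone [𝔭.IsPrime] [𝔮.IsPrime] (hP : IsPoint k 𝔭) (hQ : IsPoint k 𝔮) (h : 𝔭 ≤ 𝔮) :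
    ringKrullDim (MvPolynomial (Fin (n + 1)) k ⧸ bIdeal k 𝔮) ≤ ringKrullDim (MvPolynomial (Fin (n + 1)) k ⧸ bIdeal k 𝔭) :=
  ringKrullDim_le_of_surjective (Ideal.Quotient.factor (bIdeal_mono k p hP hQ h))
    (Ideal.Quotient.factor_surjective (bIdeal_mono k p hP hQ h))

/-- `hsDim 𝔮 ≤ hsDim 𝔭` for points `𝔭 ⊆ 𝔮` (Oda's dimension). [cite: Mizutani1973HironakaGroupSchemes, Thm. 1.3] -/
theorem hsDim_antitone [𝔭.IsPrime] [𝔮.IsPrime] (hP : IsPoint k 𝔭) (hQ : IsPoint k 𝔮) (h : 𝔭 ≤ 𝔮) : hsDim k p 𝔮 ≤ hsDim k p 𝔭 := by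
  have h1 := ringKrullDim_quotient_bIdeal_antitone k p hP hQ h
  rw [ringKrullDim_quotient_bIdeal_eq_hsDim_holds k p 𝔭 hP, ringKrullDim_quotient_bIdeal_eq_hsDim_holds k p 𝔮 hQ] at h1
  exact_mod_cast h1

include hp in
/-- `ridgeDim (U_+(𝔮)S) ≤ ridgeDim (U_+(𝔭)S)` for points `𝔭 ⊆ 𝔮`. [cite: Mizutani1973HironakaGroupSchemes, §1 (d)] -/
theorem ridgeDim_bIdeal_antitone [𝔭.IsPrime] [𝔮.IsPrime] (hP : IsPoint k 𝔭) (hQ : IsPoint k 𝔮) (h : 𝔭 ≤ 𝔮) :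
    ridgeDim (bIdeal k 𝔮) ≤ ridgeDim (bIdeal k 𝔭) := by
  have h1 := ringKrullDim_quotient_bIdeal_antitone k p hP hQ h
  rw [ringKrullDim_quotient_bIdeal_eq_ridgeDim k p 𝔭 hP, ringKrullDim_quotient_bIdeal_eq_ridgeDim k p 𝔮 hQ] at h1
  exact_mod_cast h1

/-- **The number of triangular generators grows under specialisation: `r(𝔭) ≤ r(𝔮)`** for points `𝔭 ⊆ 𝔮` and any triangular
presentations of `U(𝔭)`, `U(𝔮)`. [cite: Mizutani1973HironakaGroupSchemes, §1 (d), Thm. 1.3] -/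
theorem r_le_r_of_le [𝔭.IsPrime] [𝔮.IsPrime] (hP : IsPoint k 𝔭) (hQ : IsPoint k 𝔮) (h : 𝔭 ≤ 𝔮)
    (P : TriangularPresentation p (multAlgebra k 𝔭)) (Q : TriangularPresentation p (multAlgebra k 𝔮)) : P.r ≤ Q.r := by
  have h1 := ringKrullDim_quotient_bIdeal_antitone k p hP hQ h
  rw [ringKrullDim_quotient_bIdeal_eq_sub_r k p 𝔭 hP P, ringKrullDim_quotient_bIdeal_eq_sub_r k p 𝔮 hQ Q] at h1
  have h2 : n + 1 - Q.r ≤ n + 1 - P.r := by exact_mod_cast h1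
  have hQ' : Q.r ≤ n + 1 := Q.r_le
  have hP' : P.r ≤ n + 1 := P.r_le
  omega

end Points

/-! ## Hironaka's edge datum under specialisation -/

section Edge

variable (k : Type u) [Field k] (p : ℕ) [hp : Fact p.Prime] [CharP k p] {n : ℕ}
  {𝔭 𝔮 : Ideal (MvPolynomial (Fin (n + 1)) k)}

omit hp [CharP k p] in
/-- The Hilbert function `a ↦ dim_k U_a` is monotone in the subalgebra `U`. [folklore] -/
theorem hilbFun_mono {U U' : Subalgebra k (MvPolynomial (Fin (n + 1)) k)} (h : U ≤ U') (a : ℕ) :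
    hilbFun U a ≤ hilbFun U' a := by
  haveI : Module.Finite k (homogeneousSubmodule (Fin (n + 1)) k a) :=
    Module.Finite.iff_fg.2 (MvPolynomial.homogeneousSubmodule_fg _ _ a)
  haveI : Module.Finite k ↥(Subalgebra.toSubmodule U' ⊓ homogeneousSubmodule (Fin (n + 1)) k a) :=
    Module.Finite.of_injective (Submodule.inclusion inf_le_right) (Submodule.inclusion_injective _)
  have hle : Subalgebra.toSubmodule U ⊓ homogeneousSubmodule (Fin (n + 1)) k a ≤
      Subalgebra.toSubmodule U' ⊓ homogeneousSubmodule (Fin (n + 1)) k a :=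
    inf_le_inf_right _ fun x hx => h hx
  exact LinearMap.finrank_le_finrank_of_injective (Submodule.inclusion_injective hle)

include hp in
/-- **Hironaka's edge datum of `B_{P,·}` under specialisation**: for points `𝔭 ⊆ 𝔮`, `U(𝔭) ⊆ U(𝔮)` has the smaller Hilbert function,
so `ridgeEdgeInv p (U_+(𝔮)S) ≤ ridgeEdgeInv p (U_+(𝔭)S)` in Hironaka's lexicographic order on `(n+1, n+1−r, q_1, …, q_r, 0, …)` (tree
`edgeInvK_le_of_hilbFun_le`: the edge part of `Inv` does not rise under Hilbert-function domination).
[cite: Mizutani1973HironakaGroupSchemes, §1 (d); Hironaka2017, Eq. (34) p. 24] -/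
theorem ridgeEdgeInv_bIdeal_le_of_le [𝔭.IsPrime] [𝔮.IsPrime] (hP : IsPoint k 𝔭) (hQ : IsPoint k 𝔮) (h : 𝔭 ≤ 𝔮) :
    haveI : ExpChar k p := ExpChar.prime hp.out
    ridgeEdgeInv p (bIdeal k 𝔮) ≤ ridgeEdgeInv p (bIdeal k 𝔭) := by
  haveI : ExpChar k p := ExpChar.prime hp.out
  rw [ridgeEdgeInv_bIdeal_eq k p 𝔭 hP, ridgeEdgeInv_bIdeal_eq k p 𝔮 hQ]
  exact edgeInvK_le_of_hilbFun_le _ _ _ _ fun a => hilbFun_mono k (multAlgebra_mono k p hP hQ h) a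

end Edge

end Summit.ResolutionOfSingularities.KangarooAtlas.Mizutani

end
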